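import Literature.NumberTheory.EllipticCurves.ZpExtensionEisensteinPiLevelH2QuotientBoundProofs
import Literature.NumberTheory.GaloisRepresentations.PPrimaryDevissage
import Literature.NumberTheory.GaloisRepresentations.ContinuousCohomologySmulSequences
import HarnessLib

/-!
# `#H²(K_w, T/π^iT) ≤ p^{2p^s}`: the uniform `H²`-bound on Howard's `π`-adic Eisenstein levels at a place above `p`
# (theorems only — no definition, no named fact, no instance, no `sorry`)

Topic `NumberTheory/EllipticCurves` (cell `pub/bsd-print-x9`, shared μ-crux `MuInequalityCoherentPairOfPrint`, registered stub
`stub_h5bAtS`; brick (F4c-3)(iv) of the uniform-`ι` road; sequel of `ZpExtensionEisensteinPiLevelH2BoundProofs` (plus line) and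
`ZpExtensionEisensteinPiLevelH2QuotientBoundProofs` (graded line)).

B. Howard, Compositio Math. 140 (2004), Lemma 3.2.7 (arXiv:1202.6340 p. 16 L150–156) and §3.1.  From the short exact sequence of
local discrete `Γ_{K_w}`-modules `0 → Fil_w(T/π^iT) → T/π^iT → gr_w(T/π^iT) → 0` (`isSES_subtype_mkQ`) and the exactness of
`H²(Fil) → H²(T/π^iT) → H²(gr)` (`IsSES.exists_exact`), the two line bounds give

* **`WeierstrassCurve.natCard_two_piLevel_le`** — **`H²(K_w, Level i)` is finite of order `≤ p^{2p^s}`**, for every `π`-adic level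
  `i ≥ 1` of the curve's refinement datum, under the adapted-basis / scalar binders of the two line theorems (`κ(g₀) = p^s`,
  `p^s < m`): the uniform `H²`-exponent `c₂′ = 2p^s < m/3` of the torsion-cut readout of `F_𝔮` at `w ∣ p` (hypothesis `hH2` of
  `piTorsionCut_hLift`, after the count-to-exponent lemma `iterate_apply_eq_zero_of_natCard_le_pow`).

No summit statement is proved; BSD is not proved by any of this.

References: [Howard2004HeegnerKolyvagin] Lemma 3.2.7, §3.1, proof of Thm. 2.2.10; [MilneADT2006] I Cor. 2.3; [SerreGaloisCohomology1997]
I §2.2–2.3 (long exact sequence); [GreenbergLNM1716] §2.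
-/

set_option autoImplicit false

noncomputable section

open Function NumberField IsDedekindDomain Field Polynomial
open scoped NumberField ContRepresentation

namespace Literature.NumberTheory.EllipticCurves

namespace ZpExtension

open IwasawaAlgebra IwasawaAlgebra.EisensteinCoeff Literature.NumberTheory.GaloisRepresentations
open Literature.NumberTheory.GaloisRepresentations.DiscreteGaloisModule
open Literature.NumberTheory.GaloisCohomology.Howard2004 Literature.NumberTheory.Automorphic

/-- `#B ≤ #A · #C` for finite abelian groups in an exact sequence `A → B → C`. [folklore] -/
private theorem natCard_le_mul_of_exact {A B C : Type*} [AddCommGroup A] [AddCommGroup B] [AddCommGroup C]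
    [Finite A] [Finite B] [Finite C] (f : A →+ B) (g : B →+ C) (hfg : Function.Exact f g) :
    Nat.card B ≤ Nat.card A * Nat.card C := by
  have h1 : Nat.card B = Nat.card (B ⧸ g.ker) * Nat.card g.ker := AddSubgroup.card_eq_card_quotient_mul_card_addSubgroup _
  have h2 : Nat.card (B ⧸ g.ker) = Nat.card g.range := Nat.card_congr (QuotientAddGroup.quotientKerEquivRange g).toEquiv
  have h3 : Nat.card g.range ≤ Nat.card C :=
    Nat.card_le_card_of_injective (fun x : g.range ↦ (x : C)) Subtype.val_injective
  have h4 : g.ker = f.range := hfg.addMonoidHom_ker_eq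
  have h5 : Nat.card f.range ≤ Nat.card A := Nat.card_le_card_of_surjective f.rangeRestrict f.rangeRestrict_surjective
  rw [h1, h2, h4, mul_comm]
  exact Nat.mul_le_mul h5 h3

variable {K : Type} [Field K] [NumberField K] (E : WeierstrassCurve K) [E.IsElliptic] {p : ℕ} [hp : Fact p.Prime]
  (κ' : ZpExtension K p) {m : ℕ} (hm : 1 ≤ m)

set_option maxHeartbeats 800000 in
/-- **`#H²(K_w, T/π^iT) ≤ p^{2p^s}`, uniformly in the level.**  `D` the curve's `π`-adic refinement datum, `Φ` an ordinary datum at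
`w` with an adapted basis `P₀ ∈ Fil_w E[p^k]` (a generator of the cyclic `Fil_w`), `Q₀` of `E[p^k]` at the host level `k = host i`
(`i ≥ 1`), `g₀ ∈ Γ_{K_w}` with `κ(g₀) = p^s` (`p^s < m`) acting on `P₀` by `λ₁`, on `Q₀` by `λ₂` modulo `Fil_w`, and on `μ_{p^k}` by
the integer `c`, `p ∤ c`.  Then `H²(K_w, Level i)` is finite of order `≤ p^{2p^s}` (`0 → piFil i → Level i → gr → 0` and the two
line bounds). [cite: Howard2004HeegnerKolyvagin, Lemma 3.2.7 (arXiv:1202.6340 p. 16 L150–156) and §3.1]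
[cite: MilneADT2006, Ch. I Cor. 2.3] [cite: SerreGaloisCohomology1997, Ch. I §2.2–2.3] -/
theorem _root_.WeierstrassCurve.natCard_two_piLevel_le
    {w : HeightOneSpectrum (𝓞 K)}
    (Φ : OrdinaryFiltration (fun j ↦ E.torsionGaloisModule ((p : ℤ) ^ j)) (fun j ↦ E.torsionGaloisModuleReduce p j) w)
    {i : ℕ} (hi : 1 ≤ i)
    (P₀ Q₀ : E.geomTorsion ((p : ℤ) ^ (E.eisensteinPiRefinementDatum κ' hm).host i))
    (hP₀ : P₀ ∈ Φ.fil ((E.eisensteinPiRefinementDatum κ' hm).host i))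
    (hgen : ∀ a ∈ Φ.fil ((E.eisensteinPiRefinementDatum κ' hm).host i), ∃ n : ℤ, n • P₀ = a)
    (hPQ : ∀ a : E.geomTorsion ((p : ℤ) ^ (E.eisensteinPiRefinementDatum κ' hm).host i), ∃ n₁ n₂ : ℤ, n₁ • P₀ + n₂ • Q₀ = a)
    {g₀ : absoluteGaloisGroup (w.adicCompletion K)} {s : ℕ}
    (hg₀ : (κ' (absGaloisRestrict K (w.adicCompletion K) g₀)).toAdd = ((p ^ s : ℕ) : ℤ_[p])) (hms : p ^ s < m)
    (lam₁ : ℤ) (hlam₁ : E.torsionGaloisModule ((p : ℤ) ^ (E.eisensteinPiRefinementDatum κ' hm).host i)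
      (absGaloisRestrict K (w.adicCompletion K) g₀) P₀ = lam₁ • P₀)
    (lam₂ : ℤ) (hlam₂ : E.torsionGaloisModule ((p : ℤ) ^ (E.eisensteinPiRefinementDatum κ' hm).host i)
      (absGaloisRestrict K (w.adicCompletion K) g₀) Q₀ - lam₂ • Q₀ ∈ Φ.fil ((E.eisensteinPiRefinementDatum κ' hm).host i))
    (c : ℤ) (hc : ∀ ζ : MuCarrier (w.adicCompletion K) (p ^ (E.eisensteinPiRefinementDatum κ' hm).host i),
      mu (w.adicCompletion K) (p ^ (E.eisensteinPiRefinementDatum κ' hm).host i) g₀ ζ = c • ζ)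
    (hcp : ¬ (p : ℤ) ∣ c) :
    Finite (galoisCohomology (GaloisRep.toLocal w ((E.eisensteinPiRefinementDatum κ' hm).levelRep i)) 2) ∧
      Nat.card (galoisCohomology (GaloisRep.toLocal w ((E.eisensteinPiRefinementDatum κ' hm).levelRep i)) 2) ≤ p ^ (2 * p ^ s) := by
  classical
  haveI : CharZero (w.adicCompletion K) := charZero_of_injective_algebraMap (algebraMap K _).injective
  obtain ⟨hfinF, hF⟩ := E.natCard_two_piFil_le κ' hm Φ hi P₀ hP₀ hgen hg₀ hms lam₁ hlam₁ c hc hcp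
  obtain ⟨hfinQ, hQ⟩ := E.natCard_two_piLevel_quotient_le κ' hm Φ hi P₀ Q₀ hP₀ hPQ hg₀ hms lam₂ hlam₂ c hc hcp
  haveI := hfinF
  haveI := hfinQ
  -- finiteness of `H²(K_w, Level i)` (local duality; `p^k` kills the level)
  haveI hfinE : Finite (E.geomTorsion ((p : ℤ) ^ (E.eisensteinPiRefinementDatum κ' hm).host i)) :=
    WeierstrassCurve.finite_torsionPoints_holds E (AlgebraicClosure K) (pow_ne_zero _ (by exact_mod_cast hp.out.ne_zero))
  haveI hfinN : Finite (EisensteinLevel p m (fun j ↦ E.geomTorsion ((p : ℤ) ^ j)) ((E.eisensteinPiRefinementDatum κ' hm).host i)) :=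
    EisensteinCoeff.finite_twisted (p := p) (k := (E.eisensteinPiRefinementDatum κ' hm).host i) hm
  haveI hfinL : Finite ((E.eisensteinPiRefinementDatum κ' hm).Level i) :=
    Finite.of_surjective _ (Submodule.Quotient.mk_surjective _)
  have hM : ∀ x : (E.eisensteinPiRefinementDatum κ' hm).Level i, p ^ ((E.eisensteinPiRefinementDatum κ' hm).host i) • x = 0 := by
    intro x
    induction x using Submodule.Quotient.induction_on with
    | _ y =>
      have h0 : p ^ ((E.eisensteinPiRefinementDatum κ' hm).host i) • y = 0 :=
        EisensteinCoeff.prime_pow_nsmul_twisted (p := p) (m := m)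
          (y : Twisted p m _ (E.geomTorsion ((p : ℤ) ^ (E.eisensteinPiRefinementDatum κ' hm).host i)))
      change p ^ ((E.eisensteinPiRefinementDatum κ' hm).host i) •
          ((E.eisensteinPiRefinementDatum κ' hm).piPow ((E.eisensteinPiRefinementDatum κ' hm).host i) i).mkQ y = 0
      rw [← map_nsmul, h0, map_zero]
  obtain ⟨hfinL2, -⟩ := natCard_two_eq_natCard_invariants_homRep (w.adicCompletion K)
    (GaloisRep.toLocal w ((E.eisensteinPiRefinementDatum κ' hm).levelRep i)) hM
  haveI := hfinL2
  refine ⟨hfinL2, ?_⟩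
  -- the long exact sequence at `H²`
  obtain ⟨-, -, f₁, g₁, -, -, hex⟩ := (isSES_subtype_mkQ (GaloisRep.toLocal w ((E.eisensteinPiRefinementDatum κ' hm).levelRep i))
    (E.piFil κ' hm Φ i) (E.piFil_le_comap κ' hm Φ i)).exists_exact 1
  haveI : Finite (((GaloisRep.toLocal w ((E.eisensteinPiRefinementDatum κ' hm).levelRep i)).subrepresentation (E.piFil κ' hm Φ i)
      (E.piFil_le_comap κ' hm Φ i)).H (1 + 1)) := hfinF
  haveI : Finite ((GaloisRep.toLocal w ((E.eisensteinPiRefinementDatum κ' hm).levelRep i)).H (1 + 1)) := hfinL2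
  haveI : Finite (((GaloisRep.toLocal w ((E.eisensteinPiRefinementDatum κ' hm).levelRep i)).quotient (E.piFil κ' hm Φ i)
      (E.piFil_le_comap κ' hm Φ i)).H (1 + 1)) := hfinQ
  have hle := natCard_le_mul_of_exact f₁.toAddMonoidHom g₁.toAddMonoidHom hex
  calc Nat.card (galoisCohomology (GaloisRep.toLocal w ((E.eisensteinPiRefinementDatum κ' hm).levelRep i)) 2)
      ≤ _ * _ := hle
    _ ≤ p ^ (p ^ s) * p ^ (p ^ s) := Nat.mul_le_mul hF hQ
    _ = p ^ (2 * p ^ s) := by rw [← pow_add, two_mul]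

end ZpExtension

end Literature.NumberTheory.EllipticCurves
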